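import Mathlib.NumberTheory.Padics.Complex
import Summits.Langlands.Langlands.Statement
import Summits.Langlands.Langlands.Theorems.SkinnerWilesDefectOneEisensteinProModularSeedLevelRaisedEisensteinNewformQGlue
import Literature.NumberTheory.EllipticCurves.FramedTateGaloisRep
import Literature.NumberTheory.EllipticCurves.HasseWeilGoodReductionProofs
import Literature.NumberTheory.EllipticCurves.Isogeny
import Literature.NumberTheory.Automorphic.BCDTModularity
import Literature.NumberTheory.Automorphic.ReciprocityGLnPotentialModularity
import Literature.NumberTheory.Automorphic.AlgebraicityTwist
import Literature.NumberTheory.Automorphic.TotallyRealModularityLargeImage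
import Literature.NumberTheory.Automorphic.CaraianiNewtonResidualImageModularity
import Summits.Langlands.Langlands.Theorems.SkinnerWilesDefectOneEisensteinProModularSeedCousinAutomorphic
import HarnessLib

/-!
# `EisensteinProModularSeed` (stmt-Langlands-12920), line `descend-raise-basechange` (v6, the
# WIDE cousin graft) — stub S7f `stub_cousinAutomorphicWide`: the automorphic half of a wide cousin

This is the landed S7b `stub_cousinAutomorphic` (file
`SkinnerWilesDefectOneEisensteinProModularSeedCousinAutomorphic`) with its single unproved input —
Caraiani–Newton (2023), Cor. 6.1.1, there rendered NARROWLY through the route's hypothesis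
`SL₂(𝔽₃) ⊆ im ρ̄_{E,3}` (`CaraianiNewton2023_cor611_modular`) — replaced by the corollary AS PRINTED
(p. 87) for curves WITHOUT complex multiplication: `E / F` elliptic over an imaginary quadratic
field, `¬ E.HasCM`, and (1) `ρ̄_{E,3}|_{G_{F(ζ₃)}}` absolutely irreducible OR (2)
`ρ̄_{E,5}|_{G_{F(ζ₅)}}` absolutely irreducible (the tree's `ModPImageAbsIrreducibleOverCyclotomic E p`,
`TotallyRealModularityLargeImage`), with the conclusion "modular" read through Lemma 6.1.3 (p. 88) at
the places of good reduction exactly as in `CaraianiNewton2023_cor611_modular`: a weight-zero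
cuspidal `π` of `GL₂(𝔸_F)` with Hecke polynomial `X² − a_w(E) X + q_w` at every good `w`.  That
proposition is the NAMED FACT `CaraianiNewton2023_cor611_nonCM_printed` below (stated inline for
relocation next to its companion; its 3-adic half is LITERALLY hypothesis (A) of the tree's
`CaraianiNewton2023_cor611_modular_of_cor611_nonCM`).  It is the ONLY unproved input; in particular
alternative (2) opens the `p = 3` cousins of the line (whose `E[3]` is reducible, so that only the
5-adic hypothesis can hold).

## Contents

* `CaraianiNewton2023_cor611_nonCM_printed` — the named fact (a `def … : Prop`, cited).
* `exists_LAlgebraic_satakeFrobCompatible_of_hasWeightZero` — S7b's argument FACTORED through the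
  shape of the fact's conclusion: from a weight-zero cuspidal `π` whose Hecke polynomial at every
  `v ∉ S ⊇ {v ∣ p}` is `X² − a_v(E) X + q_v`, with `E` good off `S`, the `L`-algebraic twist
  `πF := π ⊗ |det|^{1/2}` (infinity type `T' = (weightZeroInfinityType 2 F).twist (1/2) = {(1,0),(0,1)}`,
  `L`-algebraic and regular) is Satake–Frobenius compatible (`Summit.Langlands.SatakeFrobCompatibleAt`)
  with every frame-conjugate `P · ρ_{E,p} · P⁻¹` of `E.framedTateGaloisRep p` at every `v ∉ S` —
  all ingredients are PROVED in the tree and reused by name from the S7b file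
  (`arithFrobPolyOfSatake_half_twist_pair`, `hasFrobCharpolyAt_framedTateGaloisRep_of_hasGoodReductionAt`)
  and its imports (`CuspidalAutomorphicRepData.exists_twist_hasInfinityType`,
  `exists_hasSatakeParamAt_of_hasHeckePolynomialAt_frobPoly`,
  `HasSatakeParamAt.of_map_mulChar_detTwist_of_cpow`, `isUnramifiedAt_framedTateGaloisRep`,
  `isUnramifiedAt_conj_iff`, `hasFrobCharpolyAt_conj_iff`).
* `stub_cousinAutomorphicWide` — the REGISTERED stub (skeleton v6, verbatim: the fact is its first
  hypothesis, UNFOLDED), and `stub_cousinAutomorphicWide_fact` — the same with the fact BY NAME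
  (definitionally equal statements; either proves the other by the identity term).
* `hasWideCousinHyp_of_specialLinearGroup_le_range` — sanity: the route's old (S7b) hypothesis
  `SL₂(𝔽₃) ⊆ im ρ̄_{E,3}` implies the new disjunction, by the tree's PROVED
  `modPImageAbsIrreducibleOverCyclotomic_three_of_specialLinearGroup_le_range`; and
  `CaraianiNewton2023_cor611_modular_of_nonCM_printed` — the new fact plus the small mod-`3` image of
  CM curves (hypothesis (B) of `CaraianiNewton2023_cor611_modular_of_cor611_nonCM`) give back the
  narrow fact `CaraianiNewton2023_cor611_modular`.
-/

set_option linter.dupNamespace false -- project-wide option (lakefile weak.linter.dupNamespace); `Summit.Langlands.Langlands` is the mandated namespace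

noncomputable section

namespace Summit.Langlands.Langlands.Theorems.SkinnerWilesDefectOne.EisensteinProModularSeed

open Literature.NumberTheory.Automorphic Literature.NumberTheory.GaloisRepresentations
open NumberField IsDedekindDomain Polynomial
open scoped NumberField

/-! ### The printed input (named fact, `def … : Prop`) -/

/-- **The route's S7b hypothesis implies the printed hypothesis of Cor. 6.1.1** in the form used by
`CaraianiNewton2023_cor611_nonCM_printed`: if some framing `ρ̄₃` of `E[3]` has image containing
`SL₂(𝔽₃)`, then `ρ̄_{E,3}|_{G_{K(ζ₃)}}` is absolutely irreducible for every framing and every model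
of `K(ζ₃)` (the tree's `modPImageAbsIrreducibleOverCyclotomic_three_of_specialLinearGroup_le_range`:
`det ρ̄ = χ̄₃` by the Weil pairing, so `ρ̄(G_{K(ζ₃)}) = ρ̄(G_K) ∩ SL₂(𝔽₃) = SL₂(𝔽₃)`, which acts
absolutely irreducibly), whence alternative (1) of the disjunction (1) ∨ (2).
[cite: CaraianiNewton2023, Cor. 6.1.1 (1) p. 87 and §6.1 p. 88] -/
theorem hasWideCousinHyp_of_specialLinearGroup_le_range {K : Type} [Field K] [CharZero K]
    (E : WeierstrassCurve K) [E.IsElliptic]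
    (h : ∃ ρ₃ : FramedGaloisRep K (ZMod 3) 2, E.IsTorsionGaloisRep 3 ρ₃ ∧
      ∀ g : Matrix.SpecialLinearGroup (Fin 2) (ZMod 3), ∃ σ,
        ρ₃ σ = Matrix.SpecialLinearGroup.toGL g) :
    ModPImageAbsIrreducibleOverCyclotomic E 3 ∨
      @ModPImageAbsIrreducibleOverCyclotomic K _ E 5 ⟨Nat.prime_five⟩ :=
  Or.inl (modPImageAbsIrreducibleOverCyclotomic_three_of_specialLinearGroup_le_range E h)

/-- **The printed Cor. 6.1.1 (non-CM) gives back the route's narrow fact**, granted the classical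
small image of CM curves at `3` (hypothesis (B) of `CaraianiNewton2023_cor611_modular_of_cor611_nonCM`:
for a CM curve no framing of `E[3]` has image containing `SL₂(𝔽₃)` — Silverman, *Advanced Topics*
II.2.2; taken as a HYPOTHESIS, no carrier in the tree): `CaraianiNewton2023_cor611_nonCM_printed`
restricted to alternative (1) is hypothesis (A) of that theorem.
[cite: CaraianiNewton2023, Cor. 6.1.1 (1) p. 87, Lemma 6.1.3 p. 88] -/
theorem CaraianiNewton2023_cor611_modular_of_nonCM_printed
    (h : Literature.NumberTheory.Automorphic.CaraianiNewton2023_cor611_nonCM_printed)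
    (hB : ∀ (F : Type) [Field F] [NumberField F] (E : WeierstrassCurve F) [E.IsElliptic],
      E.HasCM → ¬ ∃ ρ₃ : FramedGaloisRep F (ZMod 3) 2, E.IsTorsionGaloisRep 3 ρ₃ ∧
        ∀ g : Matrix.SpecialLinearGroup (Fin 2) (ZMod 3), ∃ σ,
          ρ₃ σ = Matrix.SpecialLinearGroup.toGL g) :
    CaraianiNewton2023_cor611_modular :=
  CaraianiNewton2023_cor611_modular_of_cor611_nonCM
    (fun F _ _ hF hF2 E _ hCM h3 ↦ h F hF hF2 E hCM (Or.inl h3)) hB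

/-! ### S7b's argument, factored through the shape of the fact's conclusion -/

/-- **From a weight-zero cuspidal `π` with Hecke polynomials `X² − a_v(E) X + q_v` off `S` to an
`L`-algebraic cuspidal `πF` Satake–Frobenius compatible with `ρ_{E,p}` off `S`.**  `F` a number
field, `p` prime, `ι : ℚ̄_p ≃ ℂ`, `E / F` elliptic with good reduction off `S ⊇ {v ∣ p}`, `π` cuspidal
on `GL₂(𝔸_F)` of weight zero with `HasHeckePolynomialAt v (X² − a_v(E) X + q_v)` at every `v ∉ S`,
`P ∈ GL₂(ℚ̄_p)`: there are a cuspidal `πF` and a regular `L`-algebraic infinity type `T'` of `πF`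
with `SatakeFrobCompatibleAt ι πF (P ρ_{E,p} P⁻¹) v` at every `v ∉ S`.  Proof (= the landed S7b,
verbatim): `πF := π ⊗ |det|^{1/2}` (`CuspidalAutomorphicRepData.exists_twist_hasInfinityType`,
Borel–Jacquet 5.7), `T' := (weightZeroInfinityType 2 F).twist (1/2) = {(1,0),(0,1)}`, `L`-algebraic
by `isCAlgebraic_iff_isLAlgebraic_twist` (Buzzard–Gee §5.3) and regular by `IsRegular.twist`; at
`v ∉ S` the Satake parameter `{z₁, z₂}` read off the Hecke polynomial
(`exists_hasSatakeParamAt_of_hasHeckePolynomialAt_frobPoly`: `q_v^{1/2}(z₁ + z₂) = a_v`,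
`q_v z₁ z₂ = q_v`) twists to `{q_v^{-1/2} z_j}` (`HasSatakeParamAt.of_map_mulChar_detTwist_of_cpow`),
whose Buzzard–Gee polynomial is `X² − a_v X + q_v` (`arithFrobPolyOfSatake_half_twist_pair`) — the
Frobenius polynomial of `ρ_{E,p}` at the good place `v ∤ p`
(`hasFrobCharpolyAt_framedTateGaloisRep_of_hasGoodReductionAt`, Silverman C.21.3), where `ρ_{E,p}`
is unramified (`isUnramifiedAt_framedTateGaloisRep`, Silverman VII.4.1); both clauses pass to the
conjugate frame (`isUnramifiedAt_conj_iff`, `hasFrobCharpolyAt_conj_iff`).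
[cite: BuzzardGeeLMS2014, Conj. 3.2.1, Rem. 3.2.5 and §5.3] -/
theorem exists_LAlgebraic_satakeFrobCompatible_of_hasWeightZero {F : Type} [Field F] [NumberField F]
    {p : ℕ} [Fact p.Prime] (ι : PadicAlgCl p ≃+* ℂ) (E : WeierstrassCurve F) [E.IsElliptic]
    {hcpt : isCompact_glFiniteIntegralLevel 2 F} (π : CuspidalAutomorphicRepData 2 F hcpt)
    (h0 : π.1.HasWeightZero) {S : Set (HeightOneSpectrum (𝓞 F))}
    (hH : ∀ v ∉ S, π.1.HasHeckePolynomialAt v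
      ((frobPoly (E.frobeniusTraceAt v) v.residueCard).map (Int.castRingHom ℂ)))
    (hSp : ∀ v : HeightOneSpectrum (𝓞 F), (p : 𝓞 F) ∈ v.asIdeal → v ∈ S)
    (hgood : ∀ v ∉ S, E.HasGoodReductionAt v) (Pfr : Matrix.GeneralLinearGroup (Fin 2) (PadicAlgCl p)) :
    ∃ (πF : CuspidalAutomorphicRepData 2 F hcpt) (T' : InfinityType F 2),
      πF.1.HasInfinityType T' ∧ T'.IsLAlgebraic ∧ T'.IsRegular ∧
      ∀ v ∉ S, Summit.Langlands.SatakeFrobCompatibleAt ι πF.1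
        (FramedRep.conj Pfr (E.framedTateGaloisRep p)) v := by
  -- the `L`-algebraic twist `πF = π ⊗ |det|^{1/2}` and its infinity type
  obtain ⟨χ, πF, hχ, hW, hW', hT'⟩ :=
    CuspidalAutomorphicRepData.exists_twist_hasInfinityType π (1 / 2 : ℝ)
      (T := weightZeroInfinityType 2 F) h0
  obtain ⟨hC, hreg⟩ := isRegularAlgebraic_weightZeroInfinityType 2 F
  refine ⟨πF, (weightZeroInfinityType 2 F).twist (((1 / 2 : ℝ)) : ℂ), hT', ?_, hreg.twist _, ?_⟩
  · -- `L`-algebraic: the `C`-algebraic weight-zero type twisted by `(n - 1)/2 = 1/2`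
    have e : (((2 : ℕ) : ℂ) - 1) / 2 = (((1 / 2 : ℝ)) : ℂ) := by push_cast; norm_num
    have hL := (InfinityType.isCAlgebraic_iff_isLAlgebraic_twist (n := 2)
      (weightZeroInfinityType 2 F)).mp hC
    rwa [e] at hL
  · intro v hv
    have hpv : (p : 𝓞 F) ∉ v.asIdeal := fun h => hv (hSp v h)
    -- the Satake parameter `{z₁, z₂}` of `π` at `v`, read off the Hecke polynomial
    obtain ⟨α, hα, hsum, hprod⟩ :=
      exists_hasSatakeParamAt_of_hasHeckePolynomialAt_frobPoly (hH v hv)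
    obtain ⟨z₁, z₂, rfl⟩ := Multiset.card_eq_two.1 hα.card_eq
    -- the Satake parameter `{q_v^{-1/2} z₁, q_v^{-1/2} z₂}` of `πF` at `v`
    have hα' := AutomorphicRepData.HasSatakeParamAt.of_map_mulChar_detTwist_of_cpow hχ hW hW' hα
    refine ⟨_, hα', ?_, ?_⟩
    · -- `ρ_{E,p}` (and its conjugate frame) is unramified at `v` (good reduction, `v ∤ p`)
      exact (FramedGaloisRep.isUnramifiedAt_conj_iff v Pfr _).2
        (E.isUnramifiedAt_framedTateGaloisRep p (hgood v hv) hpv)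
    · -- Frobenius characteristic polynomial `X² − a_v X + q_v` on both sides
      rw [hasFrobCharpolyAt_conj_iff,
        arithFrobPolyOfSatake_half_twist_pair ι (Nat.zero_lt_of_lt v.one_lt_residueCard)
          (E.frobeniusTraceAt v) hsum hprod]
      exact hasFrobCharpolyAt_framedTateGaloisRep_of_hasGoodReductionAt E p hpv (hgood v hv)

/-! ### The stub -/

/-- **stub_cousinAutomorphicWide** (S7f of line `descend-raise-basechange`, skeleton v6: the
automorphic half of a WIDE cousin) — the REGISTERED stub, verbatim (its first hypothesis is the
named fact `CaraianiNewton2023_cor611_nonCM_printed`, UNFOLDED; see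
`stub_cousinAutomorphicWide_fact` for the same statement with the fact by name).  For `F` imaginary
quadratic, `p` prime, `ι : ℚ̄_p ≃ ℂ`, an elliptic curve `E / F` without CM with
`ρ̄_{E,3}|_{G_{F(ζ₃)}}` or `ρ̄_{E,5}|_{G_{F(ζ₅)}}` absolutely irreducible, a frame-conjugate
`r = P ρ_{E,p} P⁻¹` of `E.framedTateGaloisRep p` and a finite `S ⊇ {v ∣ p}` off which `E` has good
reduction: for every `hcpt` there are a CUSPIDAL `πF` of `GL₂(𝔸_F)` and a regular `L`-algebraic
infinity type `T'` of `πF` with `SatakeFrobCompatibleAt ι πF r v` at every `v ∉ S`.  Proof: the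
fact gives a weight-zero cuspidal `π` with Hecke polynomials `X² − a_w X + q_w` at the good places
(in particular at every `w ∉ S`); conclude by `exists_LAlgebraic_satakeFrobCompatible_of_hasWeightZero`.
[cite: CaraianiNewton2023, Cor. 6.1.1 p. 87, Lemma 6.1.3 p. 88] -/
theorem stub_cousinAutomorphicWide :
  (∀ (F : Type) [Field F] [NumberField F], NumberField.IsTotallyComplex F → Module.finrank ℚ F = 2 →
    ∀ (E : WeierstrassCurve F) [E.IsElliptic], ¬ E.HasCM →
      (ModPImageAbsIrreducibleOverCyclotomic E 3 ∨
        @ModPImageAbsIrreducibleOverCyclotomic F _ E 5 ⟨Nat.prime_five⟩) →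
      ∃ (hF : isCompact_glFiniteIntegralLevel 2 F)
        (π : CuspidalAutomorphicRepData 2 F hF),
        π.1.HasWeightZero ∧
          ∀ w : HeightOneSpectrum (𝓞 F), E.HasGoodReductionAt w →
            π.1.HasHeckePolynomialAt w
              ((frobPoly (E.frobeniusTraceAt w) w.residueCard).map (Int.castRingHom ℂ))) →
    ∀ (F : Type) [Field F] [NumberField F], NumberField.IsTotallyComplex F → Module.finrank ℚ F = 2 →
      ∀ (p : ℕ) [Fact p.Prime] (ι : PadicAlgCl p ≃+* ℂ) (E : WeierstrassCurve F) [E.IsElliptic],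
      ¬ E.HasCM →
      (ModPImageAbsIrreducibleOverCyclotomic E 3 ∨
        @ModPImageAbsIrreducibleOverCyclotomic F _ E 5 ⟨Nat.prime_five⟩) →
      ∀ (r : FramedGaloisRep F (PadicAlgCl p) 2)
        (Pfr : Matrix.GeneralLinearGroup (Fin 2) (PadicAlgCl p)),
      r = FramedRep.conj Pfr (E.framedTateGaloisRep p) →
      ∀ (S : Set (HeightOneSpectrum (𝓞 F))), S.Finite →
      (∀ v : HeightOneSpectrum (𝓞 F), (p : 𝓞 F) ∈ v.asIdeal → v ∈ S) →
      (∀ v ∉ S, E.HasGoodReductionAt v) →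
      ∀ hcpt : isCompact_glFiniteIntegralLevel 2 F,
        ∃ (πF : CuspidalAutomorphicRepData 2 F hcpt) (T' : InfinityType F 2),
          πF.1.HasInfinityType T' ∧ T'.IsLAlgebraic ∧ T'.IsRegular ∧
          ∀ v ∉ S, Summit.Langlands.SatakeFrobCompatibleAt ι πF.1 r v := by
  intro hCN F _ _ hF hdeg p _ ι E _ hCM hbig r Pfr hr S _ hSp hgood hcpt
  -- Caraiani–Newton: a weight-zero cuspidal `π` with Hecke polynomial `X² − a_w X + q_w` at the
  -- places of good reduction
  obtain ⟨hF', π, h0, hH⟩ := hCN F hF hdeg E hCM hbig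
  -- `hF'` and `hcpt` are two proofs of one proposition
  obtain rfl : hF' = hcpt := rfl
  subst hr
  exact exists_LAlgebraic_satakeFrobCompatible_of_hasWeightZero ι E π h0
    (fun v hv => hH v (hgood v hv)) hSp hgood Pfr

/-- **stub_cousinAutomorphicWide, with the named fact BY NAME** (`CaraianiNewton2023_cor611_nonCM_printed
→ …`, the rest of the registered signature verbatim): definitionally the statement of
`stub_cousinAutomorphicWide` (the proof is that term), recorded so that users of the relocated fact
can apply the stub to `(h : Literature.NumberTheory.Automorphic.CaraianiNewton2023_cor611_nonCM_printed)` without unfolding.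
[cite: CaraianiNewton2023, Cor. 6.1.1 p. 87, Lemma 6.1.3 p. 88] -/
theorem stub_cousinAutomorphicWide_fact :
    Literature.NumberTheory.Automorphic.CaraianiNewton2023_cor611_nonCM_printed →
    ∀ (F : Type) [Field F] [NumberField F], NumberField.IsTotallyComplex F → Module.finrank ℚ F = 2 →
      ∀ (p : ℕ) [Fact p.Prime] (ι : PadicAlgCl p ≃+* ℂ) (E : WeierstrassCurve F) [E.IsElliptic],
      ¬ E.HasCM →
      (ModPImageAbsIrreducibleOverCyclotomic E 3 ∨
        @ModPImageAbsIrreducibleOverCyclotomic F _ E 5 ⟨Nat.prime_five⟩) →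
      ∀ (r : FramedGaloisRep F (PadicAlgCl p) 2)
        (Pfr : Matrix.GeneralLinearGroup (Fin 2) (PadicAlgCl p)),
      r = FramedRep.conj Pfr (E.framedTateGaloisRep p) →
      ∀ (S : Set (HeightOneSpectrum (𝓞 F))), S.Finite →
      (∀ v : HeightOneSpectrum (𝓞 F), (p : 𝓞 F) ∈ v.asIdeal → v ∈ S) →
      (∀ v ∉ S, E.HasGoodReductionAt v) →
      ∀ hcpt : isCompact_glFiniteIntegralLevel 2 F,
        ∃ (πF : CuspidalAutomorphicRepData 2 F hcpt) (T' : InfinityType F 2),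
          πF.1.HasInfinityType T' ∧ T'.IsLAlgebraic ∧ T'.IsRegular ∧
          ∀ v ∉ S, Summit.Langlands.SatakeFrobCompatibleAt ι πF.1 r v :=
  stub_cousinAutomorphicWide

end Summit.Langlands.Langlands.Theorems.SkinnerWilesDefectOne.EisensteinProModularSeed

end
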